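import Summits.ResolutionOfSingularities.Statement
import Literature.AlgebraicGeometry.Resolution.BlowupSequences
import Literature.AlgebraicGeometry.Resolution.EmbeddedResolutionExcellentSurfacesSequence
import Literature.AlgebraicGeometry.Resolution.DiffIdealSheaf
import Literature.AlgebraicGeometry.Resolution.ComponentGluing
import HarnessLib

/-!
# FieldColumnClasses — ground-field classes and the class-threaded pieces of the decomp-res node
    «FieldColumns»

Cell decomp-res, lens-5 g6 node FieldColumns (CRITIC-LEDGER row 38: CLEARED AS ROOT-LEVEL FIELD-COLUMN
BOOKKEEPING NODE; source HOME/decomp-res-lens-5/g6/FieldColumns.lean sha256 ecc63555…, critic's `lean check`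
rc 0).  This ROUTE-INDEPENDENT module (no `Theses` import, so that kernels files may build on it) holds the
definitions: a `FieldClass` (`C p k`), the columns `Perfect`, `Exhausted` (the tree's master class of crux
0549, verbatim), `NonExhausted`, `All`; the class-restricted summit `SummitOn C` with the two columns
`SummitPerfect`, `SummitNonExhausted` (open, `@[conjecture]`); and the six MaxContactCut chain pieces and five
pocket rungs with the class hypothesis `C p k` threaded after `[CharP k p]` (`RegularRoofsOn C`, …,
`ExhaustionBaseOn C` — the statements of items 24573 / 27129 / 28006 / 27132 / 28005 / 28004 / 28009 / 28008 /
28616 / 28617 / 28618 inlined verbatim with the extra hypothesis).  Statement-only kernels here: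
`summitOn_mono`, `summitOn_all_iff` (the summit over ALL fields is `_root_.ResolutionOfSingularities`),
`columns_of_root`.  The deciding kernels (`closes`, `root_iff_columns`, `closes_on`, `…On_of`) are in
`Theorems/MaxContactCutFieldColumns.lean`.  NO new statement items (critic: the `…On C` rungs are
class-schematic).  [EGAIV2 Prop. 6.7.4; Kollar2007 Ch. 3; BenitoVillamayor2012 = arXiv:1103.3464]
-/

open CategoryTheory AlgebraicGeometry

namespace Summit.ResolutionOfSingularities.ResolutionOfSingularities.Theorems.FieldColumnClasses

/-- A class of ground fields, indexed by the characteristic: `C p k`. -/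
abbrev FieldClass : Type 1 := ℕ → ∀ (k : Type) [Field k], Prop

/-- The PERFECT column. -/
abbrev Perfect : FieldClass := fun _ k _ => PerfectField k

/-- The tree's master class of crux 0549
    (`Theorems.hasResolution_of_perfectRes_of_exhaustedByEssFiniteType`,
verbatim): `k` is *EFT-separably exhausted* — every finite subset lies in a subfield `E`,
    essentially of
finite type over some perfect field, over which `k` is Mac Lane-separable. [folklore; EGAIV2 Prop.
    6.7.4] -/
def Exhausted (p : ℕ) (k : Type) [Field k] : Prop :=
  ∀ s : Finset k, ∃ (k₀ : Type) (_ : Field k₀) (_ : PerfectField k₀) (E : Subfield k)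
    (_ : Algebra k₀ E), Algebra.EssFiniteType k₀ E ∧ (↑s : Set k) ⊆ E ∧
      ∀ u : Finset k, LinearIndepOn E _root_.id (↑u : Set k) →
        LinearIndepOn E (fun x : k => x ^ p) (↑u : Set k)

/-- The NON-EXHAUSTED column (= the residual class of crux 0549,
    `Theorems.descentPerfectToAll_iff_residual`). -/
abbrev NonExhausted : FieldClass := fun p k _ => ¬ Exhausted p k

/-- The class of all fields. -/
abbrev All : FieldClass := fun _ _ _ => True

/-- The summit restricted to the ground fields of class `C` (ResolutionInChar with `C p k`
    threaded). -/
def SummitOn (C : FieldClass) : Prop :=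
  ∀ p : ℕ, p.Prime → ∀ (k : Type) [Field k] [CharP k p], C p k → ∀ (X :
      AlgebraicGeometry.Scheme.{0}) (f : X ⟶ AlgebraicGeometry.Spec (.of k)),
      AlgebraicGeometry.IsSeparated f → AlgebraicGeometry.LocallyOfFiniteType f →
      AlgebraicGeometry.QuasiCompact f → AlgebraicGeometry.IsReduced X →
      Literature.AlgebraicGeometry.Resolution.Scheme.HasResolution X

/-- piece · UNDECIDED(↑) · attacked conjunct (census frame F2; antecedent family of crux 0549) ·
    WEAKER than
ROOT by letter (`columns_of_root`), strictly iff 0549 is not a theorem · leaf IDEA-NEEDED (dim ≥ 4)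
    · fed by
`closes_on Perfect`. [cite: Kollar2007, Ch. 3] (B–V 2012 = arXiv:1103.3464) -/
@[conjecture] def SummitPerfect : Prop := SummitOn Perfect

/-- piece · UNDECIDED · WEAKER than ROOT by letter (`columns_of_root`); not known to imply
    `SummitPerfect`
(barrier `Literature.Barriers.ResolutionOfSingularities.InseparableBaseChange`); ⇒ crux 0549
(`descentPerfectToAll_of_nonExhausted`), ⇐ 0549 ∧ SummitPerfect (`nonExhausted_of_descent`) · leaf
IDEA-NEEDED (no reach mechanism beyond separable exhaustion) · fed by `closes_on NonExhausted` —
    the ONLY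
column on which field-free technology is owed (SEAM-2 located). [cite: EGAIV2, Prop. 6.7.4]
    (CossartJannsenSaito2020) -/
@[conjecture] def SummitNonExhausted : Prop := SummitOn NonExhausted

/-! ## The cell's deciding chain, threaded by a field class (MaxContactCut items 24573, 27129,
    28006,
27132, 28005, 28004 with `C p k` inserted after `[CharP k p]`; nothing else changed) -/

/-- threaded 24573 (residual, IDEA-NEEDED as parent; Perfect column: de Jong/Gabber alterations +
    perfect-field engines admissible) · `regularRoofsOn_of`. [cite: DeJong1996, Thm 4.1] (Kollar2007 Ch. 3) -/
def RegularRoofsOn (C : FieldClass) : Prop :=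
  ∀ p : ℕ, p.Prime → ∀ (k : Type) [Field k] [CharP k p], C p k → ∀ (X :
      AlgebraicGeometry.Scheme.{0}) (f : X ⟶ AlgebraicGeometry.Spec (.of k)),
      AlgebraicGeometry.IsSeparated f → AlgebraicGeometry.LocallyOfFiniteType f →
      AlgebraicGeometry.QuasiCompact f → AlgebraicGeometry.IsIntegral X → ∃ (Γ Y :
      AlgebraicGeometry.Scheme.{0}) (a : Γ ⟶ X) (b : Γ ⟶ Y) (g : Y ⟶ AlgebraicGeometry.Spec (.of
      k)), AlgebraicGeometry.IsSeparated g ∧ AlgebraicGeometry.LocallyOfFiniteType g ∧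
      AlgebraicGeometry.QuasiCompact g ∧ Literature.AlgebraicGeometry.Resolution.Scheme.IsRegular Y
      ∧ AlgebraicGeometry.IsReduced Γ ∧ AlgebraicGeometry.IsProper a ∧
      Literature.AlgebraicGeometry.Resolution.IsBirational a ∧ AlgebraicGeometry.IsSeparated b ∧
      AlgebraicGeometry.LocallyOfFiniteType b ∧ AlgebraicGeometry.QuasiCompact b ∧
      Literature.AlgebraicGeometry.Resolution.IsBirational b

/-- threaded 27129 on BOTH sides (support; KNOWN-MOD-PORT as parent; intended proof pointwise in
    `k`). [cite: Kollar2007, Ch. 3] (Hartshorne1977 II.7) -/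
def PencilReductionOn (C : FieldClass) : Prop :=
  (∀ p : ℕ, p.Prime → ∀ (k : Type) [Field k] [CharP k p], C p k → ∀ (Y :
      AlgebraicGeometry.Scheme.{0}) (g : Y ⟶ AlgebraicGeometry.Spec (.of k)),
      AlgebraicGeometry.IsSeparated g → AlgebraicGeometry.LocallyOfFiniteType g →
      AlgebraicGeometry.QuasiCompact g → Literature.AlgebraicGeometry.Resolution.Scheme.IsRegular Y
      → ∀ (Γ : AlgebraicGeometry.Scheme.{0}) (b : Γ ⟶ Y), AlgebraicGeometry.IsSeparated b →
      AlgebraicGeometry.LocallyOfFiniteType b → AlgebraicGeometry.QuasiCompact b →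
      Literature.AlgebraicGeometry.Resolution.IsBirational b → AlgebraicGeometry.IsReduced Γ → (∃ I
      : Y.IdealSheafData, Literature.AlgebraicGeometry.Resolution.IsBlowup b I ∧ ∀ y : Y, ∃ U :
      Y.affineOpens, y ∈ (U : Y.Opens) ∧ ∃ x h : Y.presheaf.obj (Opposite.op (U : Y.Opens)),
      I.ideal U = Ideal.span {x, h}) → Literature.AlgebraicGeometry.Resolution.Scheme.HasResolution
      Γ) → ∀ p : ℕ, p.Prime → ∀ (k : Type) [Field k] [CharP k p], C p k → ∀ (Y :
      AlgebraicGeometry.Scheme.{0}) (g : Y ⟶ AlgebraicGeometry.Spec (.of k)),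
      AlgebraicGeometry.IsSeparated g → AlgebraicGeometry.LocallyOfFiniteType g →
      AlgebraicGeometry.QuasiCompact g → Literature.AlgebraicGeometry.Resolution.Scheme.IsRegular Y
      → ∀ (Γ : AlgebraicGeometry.Scheme.{0}) (b : Γ ⟶ Y), AlgebraicGeometry.IsSeparated b →
      AlgebraicGeometry.LocallyOfFiniteType b → AlgebraicGeometry.QuasiCompact b →
      Literature.AlgebraicGeometry.Resolution.IsBirational b → AlgebraicGeometry.IsReduced Γ →
      Literature.AlgebraicGeometry.Resolution.Scheme.HasResolution Γ

/-- threaded 28006 (support as parent) · `orderBoundOn_of`. [cite: Hartshorne1977, II.7] (Giraud1975) -/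
def OrderBoundOn (C : FieldClass) : Prop :=
  ∀ p : ℕ, p.Prime → ∀ (k : Type) [Field k] [CharP k p], C p k → ∀ (Y :
      AlgebraicGeometry.Scheme.{0}) (g : Y ⟶ AlgebraicGeometry.Spec (.of k)),
      AlgebraicGeometry.IsSeparated g → AlgebraicGeometry.LocallyOfFiniteType g →
      AlgebraicGeometry.QuasiCompact g → Literature.AlgebraicGeometry.Resolution.Scheme.IsRegular Y
      → ∀ (Γ : AlgebraicGeometry.Scheme.{0}) (b : Γ ⟶ Y), AlgebraicGeometry.IsSeparated b →
      AlgebraicGeometry.LocallyOfFiniteType b → AlgebraicGeometry.QuasiCompact b →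
      Literature.AlgebraicGeometry.Resolution.IsBirational b → AlgebraicGeometry.IsReduced Γ → ∀ I
      : Y.IdealSheafData, Literature.AlgebraicGeometry.Resolution.IsBlowup b I → (∀ y : Y, ∃ U :
      Y.affineOpens, y ∈ (U : Y.Opens) ∧ ∃ x h : Y.presheaf.obj (Opposite.op (U : Y.Opens)),
      I.ideal U = Ideal.span {x, h}) → ∃ n : ℕ, ∀ y : Y,
      Literature.AlgebraicGeometry.Resolution.idealOrder I y ≤ ((n : ℕ) : ℕ∞)

/-- threaded 27132 (CLOSED-MOD-LIBRARY in dim 4 as parent, any column) ·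
    `localOrderOneResolveOn_of`. [cite: CossartJannsenSaito2020, Thm 1.4] (CossartPiltant2019) -/
def LocalOrderOneResolveOn (C : FieldClass) : Prop :=
  ∀ p : ℕ, p.Prime → ∀ (k : Type) [Field k] [CharP k p], C p k → ∀ (Y :
      AlgebraicGeometry.Scheme.{0}) (g : Y ⟶ AlgebraicGeometry.Spec (.of k)),
      AlgebraicGeometry.IsSeparated g → AlgebraicGeometry.LocallyOfFiniteType g →
      AlgebraicGeometry.QuasiCompact g → Literature.AlgebraicGeometry.Resolution.Scheme.IsRegular Y
      → ∀ (Γ : AlgebraicGeometry.Scheme.{0}) (b : Γ ⟶ Y), AlgebraicGeometry.IsSeparated b →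
      AlgebraicGeometry.LocallyOfFiniteType b → AlgebraicGeometry.QuasiCompact b →
      Literature.AlgebraicGeometry.Resolution.IsBirational b → AlgebraicGeometry.IsReduced Γ → (∃ I
      : Y.IdealSheafData, Literature.AlgebraicGeometry.Resolution.IsBlowup b I ∧ ∀ y : Y,
      Literature.AlgebraicGeometry.Resolution.idealOrder I y ≤ 1 ∧ ∃ U : Y.affineOpens, y ∈ (U :
      Y.Opens) ∧ ∃ x h : Y.presheaf.obj (Opposite.op (U : Y.Opens)), I.ideal U = Ideal.span {x, h})
      → Literature.AlgebraicGeometry.Resolution.Scheme.HasResolution Γ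

/-- threaded 28005 (contact side; Perfect column: B–V / K–M engines and the X1 port in
    print-mod-assembly at dim 4; NonExhausted column: located SEAM-2) · `stepContactOn_of`. [cite:
        Cutkosky2009, Thm 5.1] (arXiv:1103.3464, arXiv:1205.4556) -/
def StepContactOn (C : FieldClass) : Prop :=
  ∀ p : ℕ, p.Prime → ∀ (k : Type) [Field k] [CharP k p], C p k → ∀ (n : ℕ), 2 ≤ n → (∀ (Y' :
      AlgebraicGeometry.Scheme.{0}) (g' : Y' ⟶ AlgebraicGeometry.Spec (.of k)),
      AlgebraicGeometry.IsSeparated g' → AlgebraicGeometry.LocallyOfFiniteType g' →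
      AlgebraicGeometry.QuasiCompact g' → Literature.AlgebraicGeometry.Resolution.Scheme.IsRegular
      Y' → ∀ (Γ' : AlgebraicGeometry.Scheme.{0}) (b' : Γ' ⟶ Y'), AlgebraicGeometry.IsSeparated b' →
      AlgebraicGeometry.LocallyOfFiniteType b' → AlgebraicGeometry.QuasiCompact b' →
      Literature.AlgebraicGeometry.Resolution.IsBirational b' → AlgebraicGeometry.IsReduced Γ' → (∃
      I' : Y'.IdealSheafData, Literature.AlgebraicGeometry.Resolution.IsBlowup b' I' ∧ (∀ y : Y',
      Literature.AlgebraicGeometry.Resolution.idealOrder I' y ≤ ((n - 1 : ℕ) : ℕ∞)) ∧ ∀ y : Y', ∃ U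
      : Y'.affineOpens, y ∈ (U : Y'.Opens) ∧ ∃ x h : Y'.presheaf.obj (Opposite.op (U : Y'.Opens)),
      I'.ideal U = Ideal.span {x, h}) →
      Literature.AlgebraicGeometry.Resolution.Scheme.HasResolution Γ') → ∀ (Y :
      AlgebraicGeometry.Scheme.{0}) (g : Y ⟶ AlgebraicGeometry.Spec (.of k)),
      AlgebraicGeometry.IsSeparated g → AlgebraicGeometry.LocallyOfFiniteType g →
      AlgebraicGeometry.QuasiCompact g → Literature.AlgebraicGeometry.Resolution.Scheme.IsRegular Y
      → ∀ (Γ : AlgebraicGeometry.Scheme.{0}) (b : Γ ⟶ Y), AlgebraicGeometry.IsSeparated b →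
      AlgebraicGeometry.LocallyOfFiniteType b → AlgebraicGeometry.QuasiCompact b →
      Literature.AlgebraicGeometry.Resolution.IsBirational b → AlgebraicGeometry.IsReduced Γ → (∃ I
      : Y.IdealSheafData, Literature.AlgebraicGeometry.Resolution.IsBlowup b I ∧ (∀ y : Y,
      Literature.AlgebraicGeometry.Resolution.idealOrder I y ≤ ((n : ℕ) : ℕ∞)) ∧ (∀ y : Y,
      Literature.AlgebraicGeometry.Resolution.idealOrder I y = ((n : ℕ) : ℕ∞) → ∃ U :
      Y.affineOpens, ∃ hy : y ∈ (U : Y.Opens), ∃ u ∈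
      (Literature.AlgebraicGeometry.Resolution.diffIdealSheaf (g.appTop.hom.comp
      (AlgebraicGeometry.Scheme.ΓSpecIso (.of k)).inv.hom) (n - 1) I).ideal U, (Y.presheaf.germ U y
      hy).hom u ∈ IsLocalRing.maximalIdeal (Y.presheaf.stalk y) ∧ (Y.presheaf.germ U y hy).hom u ∉
      IsLocalRing.maximalIdeal (Y.presheaf.stalk y) ^ 2) ∧ ∀ y : Y, ∃ U : Y.affineOpens, y ∈ (U :
      Y.Opens) ∧ ∃ x h : Y.presheaf.obj (Opposite.op (U : Y.Opens)), I.ideal U = Ideal.span {x, h})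
      → Literature.AlgebraicGeometry.Resolution.Scheme.HasResolution Γ

/-- threaded 28004 (contact-free side = StepCFHigher ∧ StepPICore residual, lens-2 territory; same
    tags as parent on both columns — the wild dim-4 core lives over 𝔽̄_p) · `stepContactFreeOn_of`.
    [cite: Giraud1975, §2] (CossartPiltant2019, Moh1987) -/
def StepContactFreeOn (C : FieldClass) : Prop :=
  ∀ p : ℕ, p.Prime → ∀ (k : Type) [Field k] [CharP k p], C p k → ∀ (n : ℕ), 2 ≤ n → (∀ (Y' :
      AlgebraicGeometry.Scheme.{0}) (g' : Y' ⟶ AlgebraicGeometry.Spec (.of k)),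
      AlgebraicGeometry.IsSeparated g' → AlgebraicGeometry.LocallyOfFiniteType g' →
      AlgebraicGeometry.QuasiCompact g' → Literature.AlgebraicGeometry.Resolution.Scheme.IsRegular
      Y' → ∀ (Γ' : AlgebraicGeometry.Scheme.{0}) (b' : Γ' ⟶ Y'), AlgebraicGeometry.IsSeparated b' →
      AlgebraicGeometry.LocallyOfFiniteType b' → AlgebraicGeometry.QuasiCompact b' →
      Literature.AlgebraicGeometry.Resolution.IsBirational b' → AlgebraicGeometry.IsReduced Γ' → (∃
      I' : Y'.IdealSheafData, Literature.AlgebraicGeometry.Resolution.IsBlowup b' I' ∧ (∀ y : Y',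
      Literature.AlgebraicGeometry.Resolution.idealOrder I' y ≤ ((n - 1 : ℕ) : ℕ∞)) ∧ ∀ y : Y', ∃ U
      : Y'.affineOpens, y ∈ (U : Y'.Opens) ∧ ∃ x h : Y'.presheaf.obj (Opposite.op (U : Y'.Opens)),
      I'.ideal U = Ideal.span {x, h}) →
      Literature.AlgebraicGeometry.Resolution.Scheme.HasResolution Γ') → ∀ (Y :
      AlgebraicGeometry.Scheme.{0}) (g : Y ⟶ AlgebraicGeometry.Spec (.of k)),
      AlgebraicGeometry.IsSeparated g → AlgebraicGeometry.LocallyOfFiniteType g →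
      AlgebraicGeometry.QuasiCompact g → Literature.AlgebraicGeometry.Resolution.Scheme.IsRegular Y
      → ∀ (Γ : AlgebraicGeometry.Scheme.{0}) (b : Γ ⟶ Y), AlgebraicGeometry.IsSeparated b →
      AlgebraicGeometry.LocallyOfFiniteType b → AlgebraicGeometry.QuasiCompact b →
      Literature.AlgebraicGeometry.Resolution.IsBirational b → AlgebraicGeometry.IsReduced Γ → (∃ I
      : Y.IdealSheafData, Literature.AlgebraicGeometry.Resolution.IsBlowup b I ∧ (∀ y : Y,
      Literature.AlgebraicGeometry.Resolution.idealOrder I y ≤ ((n : ℕ) : ℕ∞)) ∧ (∃ y : Y,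
      Literature.AlgebraicGeometry.Resolution.idealOrder I y = ((n : ℕ) : ℕ∞) ∧ ¬ (∃ U :
      Y.affineOpens, ∃ hy : y ∈ (U : Y.Opens), ∃ u ∈
      (Literature.AlgebraicGeometry.Resolution.diffIdealSheaf (g.appTop.hom.comp
      (AlgebraicGeometry.Scheme.ΓSpecIso (.of k)).inv.hom) (n - 1) I).ideal U, (Y.presheaf.germ U y
      hy).hom u ∈ IsLocalRing.maximalIdeal (Y.presheaf.stalk y) ∧ (Y.presheaf.germ U y hy).hom u ∉
      IsLocalRing.maximalIdeal (Y.presheaf.stalk y) ^ 2)) ∧ ∀ y : Y, ∃ U : Y.affineOpens, y ∈ (U :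
      Y.Opens) ∧ ∃ x h : Y.presheaf.obj (Opposite.op (U : Y.Opens)), I.ideal U = Ideal.span {x, h})
      → Literature.AlgebraicGeometry.Resolution.Scheme.HasResolution Γ

/-- pocket rung 28009 threaded (aside) · Perfect column CLOSED-MOD-{X1|Perfect port
    (T-BV3fold-scope + assembly) + ExhaustionBridge port}; NonExhausted column UNDECIDED (located
    SEAM-2). [cite: CossartJannsenSaito2020, Thm 1.4] (B–V 2012 arXiv:1103.3464) -/
def StepContactDimFourOn (C : FieldClass) : Prop :=
  ∀ p : ℕ, p.Prime → ∀ (k : Type) [Field k] [CharP k p], C p k → ∀ (n : ℕ), 2 ≤ n → (∀ (Y' :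
      AlgebraicGeometry.Scheme.{0}) (g' : Y' ⟶ AlgebraicGeometry.Spec (.of k)),
      AlgebraicGeometry.IsSeparated g' → AlgebraicGeometry.LocallyOfFiniteType g' →
      AlgebraicGeometry.QuasiCompact g' → Literature.AlgebraicGeometry.Resolution.Scheme.IsRegular
      Y' → topologicalKrullDim Y' ≤ 4 → ∀ (Γ' : AlgebraicGeometry.Scheme.{0}) (b' : Γ' ⟶ Y'),
      AlgebraicGeometry.IsSeparated b' → AlgebraicGeometry.LocallyOfFiniteType b' →
      AlgebraicGeometry.QuasiCompact b' → Literature.AlgebraicGeometry.Resolution.IsBirational b' →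
      AlgebraicGeometry.IsReduced Γ' → (∃ I' : Y'.IdealSheafData,
      Literature.AlgebraicGeometry.Resolution.IsBlowup b' I' ∧ (∀ y : Y',
      Literature.AlgebraicGeometry.Resolution.idealOrder I' y ≤ ((n - 1 : ℕ) : ℕ∞)) ∧ ∀ y : Y', ∃ U
      : Y'.affineOpens, y ∈ (U : Y'.Opens) ∧ ∃ x h : Y'.presheaf.obj (Opposite.op (U : Y'.Opens)),
      I'.ideal U = Ideal.span {x, h}) →
      Literature.AlgebraicGeometry.Resolution.Scheme.HasResolution Γ') → ∀ (Y :
      AlgebraicGeometry.Scheme.{0}) (g : Y ⟶ AlgebraicGeometry.Spec (.of k)),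
      AlgebraicGeometry.IsSeparated g → AlgebraicGeometry.LocallyOfFiniteType g →
      AlgebraicGeometry.QuasiCompact g → Literature.AlgebraicGeometry.Resolution.Scheme.IsRegular Y
      → topologicalKrullDim Y ≤ 4 → ∀ (Γ : AlgebraicGeometry.Scheme.{0}) (b : Γ ⟶ Y),
      AlgebraicGeometry.IsSeparated b → AlgebraicGeometry.LocallyOfFiniteType b →
      AlgebraicGeometry.QuasiCompact b → Literature.AlgebraicGeometry.Resolution.IsBirational b →
      AlgebraicGeometry.IsReduced Γ → (∃ I : Y.IdealSheafData,
      Literature.AlgebraicGeometry.Resolution.IsBlowup b I ∧ (∀ y : Y,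
      Literature.AlgebraicGeometry.Resolution.idealOrder I y ≤ ((n : ℕ) : ℕ∞)) ∧ (∀ y : Y,
      Literature.AlgebraicGeometry.Resolution.idealOrder I y = ((n : ℕ) : ℕ∞) → ∃ U :
      Y.affineOpens, ∃ hy : y ∈ (U : Y.Opens), ∃ u ∈
      (Literature.AlgebraicGeometry.Resolution.diffIdealSheaf (g.appTop.hom.comp
      (AlgebraicGeometry.Scheme.ΓSpecIso (.of k)).inv.hom) (n - 1) I).ideal U, (Y.presheaf.germ U y
      hy).hom u ∈ IsLocalRing.maximalIdeal (Y.presheaf.stalk y) ∧ (Y.presheaf.germ U y hy).hom u ∉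
      IsLocalRing.maximalIdeal (Y.presheaf.stalk y) ^ 2) ∧ ∀ y : Y, ∃ U : Y.affineOpens, y ∈ (U :
      Y.Opens) ∧ ∃ x h : Y.presheaf.obj (Opposite.op (U : Y.Opens)), I.ideal U = Ideal.span {x, h})
      → Literature.AlgebraicGeometry.Resolution.Scheme.HasResolution Γ

/-- pocket rung 28008 threaded (aside) · CLOSED-MOD-LIBRARY on every column (CJS intrinsic centres,
    lens-3; or X1(1) + bridge, lens-5 g5). [cite: CossartJannsenSaito2020, Thm 1.4] (CossartPiltant2019) -/
def LocalOrderOneResolveDimFourOn (C : FieldClass) : Prop :=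
  ∀ p : ℕ, p.Prime → ∀ (k : Type) [Field k] [CharP k p], C p k → ∀ (Y :
      AlgebraicGeometry.Scheme.{0}) (g : Y ⟶ AlgebraicGeometry.Spec (.of k)),
      AlgebraicGeometry.IsSeparated g → AlgebraicGeometry.LocallyOfFiniteType g →
      AlgebraicGeometry.QuasiCompact g → Literature.AlgebraicGeometry.Resolution.Scheme.IsRegular Y
      → topologicalKrullDim Y ≤ 4 → ∀ (Γ : AlgebraicGeometry.Scheme.{0}) (b : Γ ⟶ Y),
      AlgebraicGeometry.IsSeparated b → AlgebraicGeometry.LocallyOfFiniteType b →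
      AlgebraicGeometry.QuasiCompact b → Literature.AlgebraicGeometry.Resolution.IsBirational b →
      AlgebraicGeometry.IsReduced Γ → (∃ I : Y.IdealSheafData,
      Literature.AlgebraicGeometry.Resolution.IsBlowup b I ∧ ∀ y : Y,
      Literature.AlgebraicGeometry.Resolution.idealOrder I y ≤ 1 ∧ ∃ U : Y.affineOpens, y ∈ (U :
      Y.Opens) ∧ ∃ x h : Y.presheaf.obj (Opposite.op (U : Y.Opens)), I.ideal U = Ideal.span {x, h})
      → Literature.AlgebraicGeometry.Resolution.Scheme.HasResolution Γ

/-- the port X1 = 28616 threaded (aside) · Perfect column PORT · KNOWN-MOD-{T-BV3fold-scope (B–V §4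
    beyond hypersurface-type algebras, author-asserted), assembly (ord-stratified induction on the
    marking)} (T-X1-scope: arXiv:1103.3464 Thm 2.11 + §4, arXiv:1103.3462 Thm 1.20/6.6,
    arXiv:1205.4556 local, Cutkosky2009 Thm 5.1 at c = max-ord); NonExhausted column
    UNDECIDED-in-print beyond c = 1 (CossartPiltant2019 4.3/4.4) and principal max-ord
    (CossartJannsenSaito2020) = SEAM-2 located · `markedThreefoldResolutionOn_of`. [cite:
        CossartJannsenSaito2020, Thm 1.4] (B–V 2012 arXiv:1103.3464 Thm 2.11) -/
def MarkedThreefoldResolutionOn (C : FieldClass) : Prop :=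
  ∀ c : ℕ, 1 ≤ c → ∀ p : ℕ, p.Prime → ∀ (k : Type) [Field k] [CharP k p], C p k → ∀ (S :
      AlgebraicGeometry.Scheme.{0}) (g : S ⟶ AlgebraicGeometry.Spec (.of k)),
      AlgebraicGeometry.IsSeparated g → AlgebraicGeometry.LocallyOfFiniteType g →
      AlgebraicGeometry.QuasiCompact g → Literature.AlgebraicGeometry.Resolution.Scheme.IsRegular S
      → topologicalKrullDim S ≤ 3 → ∀ J : S.IdealSheafData, (∀ y : S,
      Literature.AlgebraicGeometry.Resolution.idealOrder J y ≠ ⊤) → ∃ t :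
      Literature.AlgebraicGeometry.Resolution.CentreSeq S, t.IsResolutionOf (⟨J, [], c⟩ :
      Literature.AlgebraicGeometry.Resolution.MarkedIdeal S)

/-- pocket kernel-shaped rung 28617 threaded (aside) · ATTACKABLE on every column: the g5
    ExhaustionBridge paper proof (critic row 34 «NEW LEMMA, CORRECT») is pointwise in `k`. [cite:
        CossartJannsenSaito2020, Thm 1.4] (BierstoneGrigorievMilmanWlodarczyk2011) -/
def ExhaustionStepOn (C : FieldClass) : Prop :=
  (∀ c : ℕ, 1 ≤ c → ∀ p : ℕ, p.Prime → ∀ (k : Type) [Field k] [CharP k p], C p k → ∀ (S :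
      AlgebraicGeometry.Scheme.{0}) (g : S ⟶ AlgebraicGeometry.Spec (.of k)),
      AlgebraicGeometry.IsSeparated g → AlgebraicGeometry.LocallyOfFiniteType g →
      AlgebraicGeometry.QuasiCompact g → Literature.AlgebraicGeometry.Resolution.Scheme.IsRegular S
      → topologicalKrullDim S ≤ 3 → ∀ J : S.IdealSheafData, (∀ y : S,
      Literature.AlgebraicGeometry.Resolution.idealOrder J y ≠ ⊤) → ∃ t :
      Literature.AlgebraicGeometry.Resolution.CentreSeq S, t.IsResolutionOf (⟨J, [], c⟩ :
      Literature.AlgebraicGeometry.Resolution.MarkedIdeal S)) →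
      Literature.AlgebraicGeometry.Resolution.CossartJannsenSaito2020EmbeddedSequenceB.{0} →
      StepContactDimFourOn C

/-- pocket rung 28618 threaded (aside) · ATTACKABLE, hypothesis CLOSED-MOD-LIBRARY on every column
    (the c = 1 slice of X1 is in print over any field: CossartPiltant2019 4.3/4.4 + CJS). [cite:
        CossartPiltant2019, Prop. 4.4] (CossartJannsenSaito2020) -/
def ExhaustionBaseOn (C : FieldClass) : Prop :=
  (∀ p : ℕ, p.Prime → ∀ (k : Type) [Field k] [CharP k p], C p k → ∀ (S :
      AlgebraicGeometry.Scheme.{0}) (g : S ⟶ AlgebraicGeometry.Spec (.of k)),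
      AlgebraicGeometry.IsSeparated g → AlgebraicGeometry.LocallyOfFiniteType g →
      AlgebraicGeometry.QuasiCompact g → Literature.AlgebraicGeometry.Resolution.Scheme.IsRegular S
      → topologicalKrullDim S ≤ 3 → ∀ J : S.IdealSheafData, (∀ y : S,
      Literature.AlgebraicGeometry.Resolution.idealOrder J y ≠ ⊤) → ∃ t :
      Literature.AlgebraicGeometry.Resolution.CentreSeq S, t.IsResolutionOf (⟨J, [], 1⟩ :
      Literature.AlgebraicGeometry.Resolution.MarkedIdeal S)) →
      Literature.AlgebraicGeometry.Resolution.CossartJannsenSaito2020EmbeddedSequenceB.{0} →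
      LocalOrderOneResolveDimFourOn C

/-! ## Kernels -/


open Literature.AlgebraicGeometry.Resolution

/-- Monotonicity of the restricted summit in the class. [folklore] -/
theorem summitOn_mono {C D : FieldClass} (hCD : ∀ (p : ℕ) (k : Type) [Field k], C p k → D p k)
    (h : SummitOn D) : SummitOn C :=
  fun p hp k _ _ hk X f a b c d => h p hp k (hCD p k hk) X f a b c d

/-- The summit over ALL fields is the root. [folklore] -/
theorem summitOn_all_iff : SummitOn All ↔ _root_.ResolutionOfSingularities := by
  constructor
  · intro h
    exact _root_.ResolutionOfSingularities_iff.mpr fun p hp k _ _ X f a b c d =>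
      h p hp k trivial X f a b c d
  · intro h p hp k _ _ _ X f a b c d
    exact _root_.ResolutionOfSingularities_iff.mp h p hp k X f a b c d

/-- (⇒) Both columns are slices of the root. [folklore] -/
theorem columns_of_root (h : _root_.ResolutionOfSingularities) :
    SummitPerfect ∧ SummitNonExhausted :=
  ⟨summitOn_mono (D := All) (fun _ _ _ _ => trivial) (summitOn_all_iff.mpr h),
   summitOn_mono (D := All) (fun _ _ _ _ => trivial) (summitOn_all_iff.mpr h)⟩

end Summit.ResolutionOfSingularities.ResolutionOfSingularities.Theorems.FieldColumnClasses
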